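/-
Copyright (c) 2026. All rights reserved.
Released under Apache 2.0 license as described in the file LICENSE.
Authors: abc-iut cell — seat abc-iut-L4-t8 (gen 9; proof-only companion of `HolomorphicCores.lean`,
typed by abc-iut-L4-t2 / abc-iut-L4-t14; [AbsTopIII] Cor 2.4 (b), first sentence — uniqueness half).
-/
import Literature.AnabelianGeometry.AbsoluteAnabelian.HolomorphicCores
import Literature.AnabelianGeometry.AbsoluteAnabelian.AutHolomorphicSpacesExtendProofs
import Mathlib.Topology.Homeomorph.Lemmas
import HarnessLib

/-!
# Proof-only companion of `HolomorphicCores`: the lifted structure of [AbsTopIII] Cor 2.4 (b) is unique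

S. Mochizuki, *Topics in absolute anabelian geometry III*, Cor 2.4 (b) (kurims p.54): «by considering the
local structure on `U^top` consisting of connected open subsets of `U^top` that map isomorphically onto
open subsets of `X^top`, one may construct a natural pre-Aut-holomorphic structure on `U^top` — hence
also [cf. Corollary 2.3, (ii)] a natural Aut-holomorphic structure on `U^top` — by restricting the
Aut-holomorphic structure of `𝕏` on `X^top`».  The statement file records the lifted structure as the
predicate `IsLiftedStructure A p AU` (`𝒜_U` makes `p` a `(𝒰_p, 𝒲)`-local morphism, `𝒰_p` = the
connected opens on which `p` is injective).  Existence («the charted structure is a lifted structure»)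
is `isLiftedStructure_ofCharted` (`HolomorphicCoresFunctorialityProofs`).  Here: the UNIQUENESS half.

* `isLocalStructure_injOn` — for an étale `p : U → X` with `U` locally connected, `𝒰_p` IS a local
  structure in the sense of Def 2.1 (i) (`IsLocalStructure`): a basis of connected opens, closed under
  connected open subsets — so «pre-Aut-holomorphic structure on `U^top`» (a `𝒰_p`-local one) makes sense;
* `aut_eq_of_isLiftedStructure` / `restrict_eq_of_isLiftedStructure` — the `𝒰_p`-local pre-Aut-holomorphic
  structure is DETERMINED by `𝒜_X`: two lifted structures agree on every member of `𝒰_p` (their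
  `A(V)` are carried by the same conjugation onto `A_X(p(V))`);
* `ofCharted_eq_of_isLiftedStructure` — «hence also [cf. Corollary 2.3, (ii)] a natural Aut-holomorphic
  structure on `U^top`»: two complex structures on `U^top` whose Aut-holomorphic structures are both
  lifted along `p` have THE SAME Aut-holomorphic structure — by Cor 2.3 (ii)
  (`preAutHolStructureExtendsUnique_holds`, abc-iut-L4-t7) applied on the local structure `𝒰_p`.

Everything is stated directly as theorems (no `def … : Prop`).  Refereed pre-IUT material; nothing
here bears on the disputed [IUTchIII] Cor. 3.12; no side is taken.
-/

noncomputable section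

namespace Literature.AnabelianGeometry.AbsoluteAnabelian

open _root_.TopologicalSpace _root_.Topology _root_.Set _root_.Function
open scoped _root_.Manifold _root_.ContDiff

universe u

/-! ### The injectivity opens of an étale map form a local structure -/

section LocalStructure

variable {X : Type u} [TopologicalSpace X] {U : Type u} [TopologicalSpace U]

/-- **The printed local structure of Cor 2.4 (b) is a local structure.**  For an étale map
`p : U^top → X^top` (e.g. a covering) of a locally connected space, the collection `𝒰_p` of «connected
open subsets of `U^top` that map isomorphically onto open subsets of `X^top`» — connected opens on which
`p` is injective — is a local structure on `U^top` (Def 2.1 (i)): its members are connected, they form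
a basis (every point has arbitrarily small connected open neighbourhoods inside a sheet of `p`), and a
connected open subset of a member is a member.
[cite: MochizukiAbsTopIII2015, Corollary 2.4 (b) p.54] -/
theorem isLocalStructure_injOn [LocallyConnectedSpace U] {p : U → X} (hp : IsLocalHomeomorph p) :
    IsLocalStructure U {V : Opens U | IsConnected (V : Set U) ∧ InjOn p V} := by
  refine ⟨fun V hV => hV.1, ?_, fun V hV W hW hWV => ⟨hW, hV.2.mono (by exact_mod_cast hWV)⟩⟩
  rw [Opens.isBasis_iff_nbhd]
  intro O x hx
  obtain ⟨e, hxe, hpe⟩ := hp x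
  -- a connected open neighbourhood of `x` inside `O ∩ e.source`
  obtain ⟨W, hWsub, hWo, hxW, hWc⟩ :=
    locallyConnectedSpace_iff_subsets_isOpen_isConnected.mp ‹_› x ((O : Set U) ∩ e.source)
      ((O.isOpen.inter e.open_source).mem_nhds ⟨hx, hxe⟩)
  refine ⟨⟨W, hWo⟩, ⟨hWc, ?_⟩, hxW, fun y hy => (hWsub hy).1⟩
  intro a ha b hb hab
  have ha' : a ∈ e.source := (hWsub ha).2
  have hb' : b ∈ e.source := (hWsub hb).2
  rw [hpe] at hab
  exact e.injOn ha' hb' hab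

end LocalStructure

/-! ### Two lifted structures agree on the local structure `𝒰_p` -/

section Unique

variable {X : Type u} [TopologicalSpace X] {U : Type u} [TopologicalSpace U]

/-- For `V ∈ 𝒰_p` (connected open, `p` injective on `V`) and `p` étale: the homeomorphism
`e : V ≃ W := p(V)` induced by `p` onto a connected open `W ⊆ X^top`, with `e x = p x`.
[cite: MochizukiAbsTopIII2015, Corollary 2.4 (b) p.54] -/
theorem exists_homeomorph_of_injOn {p : U → X} (hp : IsLocalHomeomorph p) {V : Opens U}
    (hVc : IsConnected (V : Set U)) (hVi : InjOn p V) :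
    ∃ (W : Opens X) (e : V ≃ₜ W), IsConnected (W : Set X) ∧ ∀ x : V, (e x : X) = p x := by
  -- the restriction `V → X` is an open embedding
  have hinj : Function.Injective (fun v : V => p v) := by
    intro a b hab
    exact Subtype.ext (hVi a.2 b.2 hab)
  have hopen : IsOpenMap (fun v : V => p v) := hp.isOpenMap.restrict V.isOpen
  have hemb : IsOpenEmbedding (fun v : V => p v) :=
    IsOpenEmbedding.of_continuous_injective_isOpenMap
      (hp.continuous.comp continuous_subtype_val) hinj hopen
  have hrange : Set.range (fun v : V => p v) = p '' (V : Set U) := by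
    ext y; constructor
    · rintro ⟨v, rfl⟩; exact ⟨v, v.2, rfl⟩
    · rintro ⟨v, hv, rfl⟩; exact ⟨⟨v, hv⟩, rfl⟩
  refine ⟨⟨p '' (V : Set U), hp.isOpenMap _ V.isOpen⟩,
    hemb.isEmbedding.toHomeomorph.trans (Homeomorph.setCongr hrange),
    hVc.image p hp.continuous.continuousOn, fun x => ?_⟩
  rfl

/-- **Two lifted structures agree on `𝒰_p`.**  If `𝒜₁`, `𝒜₂` are Aut-holomorphic structures on `U^top`
both lifted along the étale `p` from `𝒜_X` (`IsLiftedStructure`), then `𝒜₁(V) = 𝒜₂(V)` for every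
connected open `V` on which `p` is injective: conjugation by `e : V ≅ p(V)` carries both onto
`𝒜_X(p(V))`, and `Subgroup.map` along a group isomorphism is injective.
[cite: MochizukiAbsTopIII2015, Corollary 2.4 (b) p.54] -/
theorem aut_eq_of_isLiftedStructure {A : AutHolStructure X} {p : U → X} {AU₁ AU₂ : AutHolStructure U}
    (h₁ : IsLiftedStructure A p AU₁) (h₂ : IsLiftedStructure A p AU₂) (V : ConnectedOpens U)
    (hVi : InjOn p V.1) : AU₁.aut V = AU₂.aut V := by
  obtain ⟨W, e, hWc, he⟩ := exists_homeomorph_of_injOn h₁.isLocalHomeomorph V.2 hVi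
  have hV𝒰 : V.1 ∈ {V : Opens U | IsConnected (V : Set U) ∧ InjOn p V} := ⟨V.2, hVi⟩
  have hW𝒲 : W ∈ {W : Opens X | IsConnected (W : Set X)} := hWc
  have e1 := h₁.map_aut_eq V ⟨W, hWc⟩ hV𝒰 hW𝒲 e he
  have e2 := h₂.map_aut_eq V ⟨W, hWc⟩ hV𝒰 hW𝒲 e he
  exact Subgroup.map_injective (homeoConj e).injective (e1.trans e2.symm)

/-- **The `𝒰_p`-local pre-Aut-holomorphic structure of Cor 2.4 (b) is determined by `𝒜_X`**: two lifted
structures have the same restriction to the local structure `𝒰_p`.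
[cite: MochizukiAbsTopIII2015, Corollary 2.4 (b) p.54] -/
theorem restrict_eq_of_isLiftedStructure [LocallyConnectedSpace U] {A : AutHolStructure X}
    {p : U → X} {AU₁ AU₂ : AutHolStructure U} (h₁ : IsLiftedStructure A p AU₁)
    (h₂ : IsLiftedStructure A p AU₂) :
    AU₁.restrict (isLocalStructure_injOn h₁.isLocalHomeomorph) =
      AU₂.restrict (isLocalStructure_injOn h₁.isLocalHomeomorph) := by
  unfold AutHolStructure.restrict
  congr 1
  funext V
  exact aut_eq_of_isLiftedStructure h₁ h₂ ⟨V.1, V.2.1⟩ V.2.2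

end Unique

/-! ### «hence also [Cor 2.3 (ii)] a natural Aut-holomorphic structure on `U^top`» -/

section Charted

/-- **[AbsTopIII] Cor 2.4 (b), first sentence — UNIQUENESS of the lifted Aut-holomorphic structure.**
Let `p : U^top → X` be étale onto a Riemann surface `X` (e.g. a universal covering), `U^top` Hausdorff,
and let `c₁`, `c₂` be two complex structures on `U^top` (Riemann-surface structures) whose
Aut-holomorphic structures `𝒜_{(U,c₁)}`, `𝒜_{(U,c₂)}` are both LIFTED along `p` from `𝒜_X` (e.g. both
make `p` holomorphic, `isLiftedStructure_ofCharted`).  Then `𝒜_{(U,c₁)} = 𝒜_{(U,c₂)}`: the two agree on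
the local structure `𝒰_p` (`restrict_eq_of_isLiftedStructure`), hence everywhere by Cor 2.3 (ii)
(«every pre-Aut-holomorphic structure extends to a unique Aut-holomorphic structure»,
`preAutHolStructureExtendsUnique_holds`).  This is the printed «natural Aut-holomorphic structure on
`U^top`», denoted `𝕌`.
[cite: MochizukiAbsTopIII2015, Corollary 2.4 (b) p.54] -/
theorem ofCharted_eq_of_isLiftedStructure {X : Type} [TopologicalSpace X] [ChartedSpace ℂ X]
    (U : Type) [TopologicalSpace U] [T2Space U] (c₁ c₂ : ChartedSpace ℂ U)
    (m₁ : @IsManifold ℂ _ ℂ _ _ ℂ _ 𝓘(ℂ, ℂ) ω U _ c₁) (m₂ : @IsManifold ℂ _ ℂ _ _ ℂ _ 𝓘(ℂ, ℂ) ω U _ c₂)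
    {p : U → X}
    (h₁ : IsLiftedStructure (AutHolStructure.ofCharted X) p (@AutHolStructure.ofCharted U _ c₁))
    (h₂ : IsLiftedStructure (AutHolStructure.ofCharted X) p (@AutHolStructure.ofCharted U _ c₂)) :
    @AutHolStructure.ofCharted U _ c₁ = @AutHolStructure.ofCharted U _ c₂ := by
  haveI : LocallyConnectedSpace U := @ChartedSpace.locallyConnectedSpace ℂ U _ _ c₁ _
  exact preAutHolStructureExtendsUnique_holds U c₁ c₂ m₁ m₂ _
    (isLocalStructure_injOn h₁.isLocalHomeomorph) (restrict_eq_of_isLiftedStructure h₁ h₂)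

end Charted

end Literature.AnabelianGeometry.AbsoluteAnabelian

end
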